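import Summits.PneNP.PneNP.Theorems.ChebyshevTracialDesignGammaDirectionExp
import Summits.PneNP.PneNP.Theorems.ChebyshevTracialDesignCrossingPlaneAverage
import HarnessLib

/-!
# Cell pnp-psdrank, route `ChebyshevTracialDesign`: (CG_1′) IN EVERY TYPE-CONSTANT DIRECTION, AVERAGED OVER ALL MATCHINGS —
# brick 144 (crux `TracialDecayExp20`, stmt-PneNP-19878)

Brick 144 (prover g29; MEMO-31 §6: «then brick 144 = the M-average (brick 127 pattern)»). Brick 143
(`…GammaDirectionExp.gammaDirection_value_le_exp`) bounds the per-matching value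
`V(M) = |PM|·Σ_U W(U,M)·ψ(|U∩H|)·C_{γ,λ,κ}(U,M)²`, `C_{γ,λ,κ}(U,M) = Σ_p (γ[p,πp ∈ H] + λ([p,πp ∈ H] − [p,πp ∉ H]) + (λ+κ))·x_p x_{πp}`
(the general TYPE-CONSTANT direction: coefficient `γ + 2λ + κ` on `HH` edges, `κ` on `H̄H̄` edges, `λ + κ` on mixed edges), of an
`H`-symmetric tilted mask by `2·10⁴(1+B_v)G n⁶ e^{−a′D}` for every NON-ALIGNED matching (`n/40 < b_M(H) < n/2 − n/40` crossing edges,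
`|H| = n/2`). Exactly as brick 127 did for brick 126, the ALIGNED matchings are an exponentially small fraction by the engine's
crossing-count tails (`ChebyshevTracialDesignCrossingCountTailsExplicit.card_pmatch_crosses_le_le` / `card_pmatch_le_crosses_le`, mass
`≤ 2·2^{−⌊n/40⌋}`), and on them the trivial bound `|V(M)| ≤ 16n²G·B_v` suffices:

* §1 `abs_gammaForm_le`, **`gamma_value_le_trivial`** — `|C_{γ,λ,κ}(U,M)| ≤ 4n`, and `V(M) ≤ 16n²·G·B_v` for EVERY matching.
* §2 **`gammaDirection_designValue_le`** — THE M-AVERAGE: for every `a′ > 0` there is `n₀` such that for `n ≥ n₀`, every balanced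
  exact design (`2 ≤ D`, `D⁴ ≤ n`, `2D+1 ≤ T ≤ 7⌊√n⌋`), every balanced block `|H| = n/2`, every `0 ≤ ψ ≤ G`, `|γ|,|λ|,|κ| ≤ 1`:
  `Σ_M Σ_U W(U,M)·ψ(|U∩H|)·C_{γ,λ,κ}(U,M)² ≤ 2·10⁴·(1+B_v)·G·n⁶·(e^{−a′D} + 2^{−⌊n/40⌋})`.
* §3 **`gammaDirection_designValue_le_chebyshev`** — the same in the crux's vocabulary (`IsBalancedDesign n t (Tq n) (dq n) 20 C w`):
  `≤ 42·10⁴·G·n⁶·(e^{−a′·dq n} + 2^{−⌊n/40⌋})`.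
READING: the design value of every `H`-symmetric mask tilted by the square of ANY type-constant containment form — the full
three-parameter family (γ, λ, κ) of MEMO-25 §4, i.e. (O1)+(O2)+(O3) — is `≤ poly(n)·(e^{−a′D} + 2^{−n/40})`: (CG_1′) for this class,
unconditionally, M-averaged, ASYMPTOTIC ONLY. WHAT THIS FILE DOES NOT DO: unbalanced blocks `|H| ≠ n/2`, directions that are not
type-constant (general `v ∈ [−1,1]^M`), spread (non-`H`-symmetric) masks, the structure theorem for general psd strategies — nothing on
`TracialDecayExp20` itself, psd rank of P_PM(K_n), or P vs NP. [cite: Rothvoss2017, §2 (PDF pp. 5–6)] [cite: RollinRoss2010, §4.1 Thm 4.2]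
[cite: Durrett2019, §2.7]
Stature: support/instrument (kernel lane, no defs, axioms standard). Supports stmt-PneNP-19878.
-/

set_option linter.dupNamespace false -- `Summit.PneNP.PneNP.…`: summit = sub-problem (D-0017)

noncomputable section

namespace Summit.PneNP.PneNP.Theorems.ChebyshevTracialDesignGammaDirectionAverage

open Finset Literature.Barriers.PneNP Literature.Combinatorics.Optimization
open Literature.Combinatorics.Optimization.ShellStep
open Literature.Combinatorics.SimpleGraph.CycleSpace
open Summit.PneNP.PneNP.Theorems.ChebyshevTracialDesignShellOperatorForm (designValue_eq_shellAvg)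
open Summit.PneNP.PneNP.Theorems.ChebyshevTracialDesignGammaDirectionExp (gammaDirection_value_le_exp)
open Summit.PneNP.PneNP.Theorems.ChebyshevTracialDesignCrossingPlaneAverage (card_reps_vB_eq_card_crosses dq_Tq_facts)
open Summit.PneNP.PneNP.Theorems.ChebyshevTracialDesignCrossingCountTailsExplicit
  (card_pmatch_crosses_le_le card_pmatch_le_crosses_le)

variable {n : ℕ}

/-! ### §1 The trivial per-matching bound -/

/-- The type-constant containment form is bounded: `|Σ_p (γ[p,πp ∈ H] + λ([p,πp ∈ H] − [p,πp ∉ H]) + (λ+κ))·x_p x_{πp}| ≤ 4n` for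
`|γ|, |λ|, |κ| ≤ 1`. [cite: Rothvoss2017, §2 (PDF p. 6)] -/
theorem abs_gammaForm_le (M : PMatch n) (H U : Finset (Fin n)) {gam lam kap : ℝ} (hgam : |gam| ≤ 1) (hlam : |lam| ≤ 1)
    (hkap : |kap| ≤ 1) :
    |∑ p : Fin n, (gam * (if (p ∈ H ∧ M.2.partner p ∈ H) then (1 : ℝ) else 0) +
        (lam * ((if (p ∈ H ∧ M.2.partner p ∈ H) then (1 : ℝ) else 0) -
          (if (p ∉ H ∧ M.2.partner p ∉ H) then (1 : ℝ) else 0)) + (lam + kap))) *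
        ((if p ∈ U then (1 : ℝ) else 0) * (if M.2.partner p ∈ U then (1 : ℝ) else 0))| ≤ 4 * n := by
  refine (abs_sum_le_sum_abs _ _).trans ?_
  have hterm : ∀ p : Fin n, |(gam * (if (p ∈ H ∧ M.2.partner p ∈ H) then (1 : ℝ) else 0) +
      (lam * ((if (p ∈ H ∧ M.2.partner p ∈ H) then (1 : ℝ) else 0) -
        (if (p ∉ H ∧ M.2.partner p ∉ H) then (1 : ℝ) else 0)) + (lam + kap))) *
      ((if p ∈ U then (1 : ℝ) else 0) * (if M.2.partner p ∈ U then (1 : ℝ) else 0))| ≤ 4 := by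
    intro p
    rw [abs_mul]
    have h1 : |gam * (if (p ∈ H ∧ M.2.partner p ∈ H) then (1 : ℝ) else 0) +
        (lam * ((if (p ∈ H ∧ M.2.partner p ∈ H) then (1 : ℝ) else 0) -
          (if (p ∉ H ∧ M.2.partner p ∉ H) then (1 : ℝ) else 0)) + (lam + kap))| ≤ 4 := by
      have hg := abs_le.1 hgam; have hl := abs_le.1 hlam; have hk := abs_le.1 hkap
      rw [abs_le]; constructor <;> split_ifs <;> nlinarith
    have h2 : |(if p ∈ U then (1 : ℝ) else 0) * (if M.2.partner p ∈ U then (1 : ℝ) else 0)| ≤ 1 := by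
      rw [abs_le]; constructor <;> split_ifs <;> norm_num
    calc _ ≤ 4 * 1 := mul_le_mul h1 h2 (abs_nonneg _) (by norm_num)
      _ = 4 := by norm_num
  calc _ ≤ ∑ _p : Fin n, (4 : ℝ) := sum_le_sum fun p _ => hterm p
    _ = 4 * n := by rw [sum_const, card_univ, Fintype.card_fin, nsmul_eq_mul]; ring

/-- **Trivial per-matching bound**: for every matching `M`, block `H`, `|ψ| ≤ G` on `[0,t]` and `|γ|,|λ|,|κ| ≤ 1`,
`|PM|·Σ_U W(U,M)·ψ(|U∩H|)·C_{γ,λ,κ}(U,M)² ≤ 16n²·G·B_v` (total variation of the design). [cite: Rothvoss2017, §2 (PDF p. 6)] -/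
theorem gamma_value_le_trivial {t T D : ℕ} {Bv : ℝ} {C : Finset ℕ} {w : ℕ → ℝ} (hdes : IsExactDesign n t T D Bv C w)
    (M : PMatch n) (H : Finset (Fin n)) (ψ : ℤ → ℝ) {G : ℝ} (hG0 : 0 ≤ G)
    (hG : ∀ x ∈ Icc (0 : ℤ) ((t : ℕ) : ℤ), |ψ x| ≤ G) {gam lam kap : ℝ} (hgam : |gam| ≤ 1) (hlam : |lam| ≤ 1)
    (hkap : |kap| ≤ 1) :
    (Fintype.card (PMatch n) : ℝ) * ∑ U : OddSet n, levelWeight n t C w U M *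
        (ψ ((U.1 ∩ H).card : ℤ) *
          (∑ p : Fin n, (gam * (if (p ∈ H ∧ M.2.partner p ∈ H) then (1 : ℝ) else 0) +
              (lam * ((if (p ∈ H ∧ M.2.partner p ∈ H) then (1 : ℝ) else 0) -
                (if (p ∉ H ∧ M.2.partner p ∉ H) then (1 : ℝ) else 0)) + (lam + kap))) *
            ((if p ∈ U.1 then (1 : ℝ) else 0) * (if M.2.partner p ∈ U.1 then (1 : ℝ) else 0))) ^ 2) ≤
      16 * (n : ℝ) ^ 2 * G * Bv := by
  have hPM : (Fintype.card (PMatch n) : ℝ) ≠ 0 := by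
    have : 0 < Fintype.card (PMatch n) := Fintype.card_pos_iff.2 ⟨M⟩
    positivity
  rw [designValue_eq_shellAvg t hdes.1 C w M (fun U' => ψ ((U' ∩ H).card : ℤ) *
      (∑ p : Fin n, (gam * (if (p ∈ H ∧ M.2.partner p ∈ H) then (1 : ℝ) else 0) +
          (lam * ((if (p ∈ H ∧ M.2.partner p ∈ H) then (1 : ℝ) else 0) -
            (if (p ∉ H ∧ M.2.partner p ∉ H) then (1 : ℝ) else 0)) + (lam + kap))) *
        ((if p ∈ U' then (1 : ℝ) else 0) * (if M.2.partner p ∈ U' then (1 : ℝ) else 0))) ^ 2),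
    ← mul_assoc, mul_inv_cancel₀ hPM, one_mul]
  -- each shell average is at most `16n²G`
  have havg : ∀ c ∈ C, |(∑ U' ∈ shell M.2.partner t c, ψ ((U' ∩ H).card : ℤ) *
      (∑ p : Fin n, (gam * (if (p ∈ H ∧ M.2.partner p ∈ H) then (1 : ℝ) else 0) +
          (lam * ((if (p ∈ H ∧ M.2.partner p ∈ H) then (1 : ℝ) else 0) -
            (if (p ∉ H ∧ M.2.partner p ∉ H) then (1 : ℝ) else 0)) + (lam + kap))) *
        ((if p ∈ U' then (1 : ℝ) else 0) * (if M.2.partner p ∈ U' then (1 : ℝ) else 0))) ^ 2) /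
      ((shell M.2.partner t c).card : ℝ)| ≤ 16 * (n : ℝ) ^ 2 * G := by
    intro c _
    have hb : ∀ U' ∈ shell M.2.partner t c, |ψ ((U' ∩ H).card : ℤ) *
        (∑ p : Fin n, (gam * (if (p ∈ H ∧ M.2.partner p ∈ H) then (1 : ℝ) else 0) +
            (lam * ((if (p ∈ H ∧ M.2.partner p ∈ H) then (1 : ℝ) else 0) -
              (if (p ∉ H ∧ M.2.partner p ∉ H) then (1 : ℝ) else 0)) + (lam + kap))) *
          ((if p ∈ U' then (1 : ℝ) else 0) * (if M.2.partner p ∈ U' then (1 : ℝ) else 0))) ^ 2| ≤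
        16 * (n : ℝ) ^ 2 * G := by
      intro U' hU'
      have hUt : U'.card = t := ((mem_shell).1 hU').1
      have hx : ((U' ∩ H).card : ℤ) ∈ Icc (0 : ℤ) ((t : ℕ) : ℤ) := by
        rw [mem_Icc]; refine ⟨by positivity, ?_⟩
        have := card_le_card (inter_subset_left (s₁ := U') (s₂ := H))
        rw [hUt] at this; exact_mod_cast this
      have h1 := hG _ hx
      have h2 := abs_gammaForm_le M H U' hgam hlam hkap
      rw [abs_mul, abs_pow]
      have h3 : |∑ p : Fin n, (gam * (if (p ∈ H ∧ M.2.partner p ∈ H) then (1 : ℝ) else 0) +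
          (lam * ((if (p ∈ H ∧ M.2.partner p ∈ H) then (1 : ℝ) else 0) -
            (if (p ∉ H ∧ M.2.partner p ∉ H) then (1 : ℝ) else 0)) + (lam + kap))) *
          ((if p ∈ U' then (1 : ℝ) else 0) * (if M.2.partner p ∈ U' then (1 : ℝ) else 0))| ^ 2 ≤ (4 * n) ^ 2 :=
        pow_le_pow_left₀ (abs_nonneg _) h2 2
      nlinarith [abs_nonneg (ψ ((U' ∩ H).card : ℤ)), h1, h3, hG0]
    by_cases h0 : (shell M.2.partner t c).card = 0
    · rw [h0, Nat.cast_zero, div_zero, abs_zero]; positivity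
    have hpos : (0 : ℝ) < (shell M.2.partner t c).card := by positivity
    rw [abs_div, abs_of_pos hpos, div_le_iff₀ hpos]
    refine (abs_sum_le_sum_abs _ _).trans ?_
    calc _ ≤ ∑ _U' ∈ shell M.2.partner t c, 16 * (n : ℝ) ^ 2 * G := sum_le_sum hb
      _ = 16 * (n : ℝ) ^ 2 * G * (shell M.2.partner t c).card := by rw [sum_const, nsmul_eq_mul]; ring
  have hvar : ∑ c ∈ C, |w c| ≤ Bv := hdes.2.2.2.2.2.2
  refine (le_abs_self _).trans ((abs_sum_le_sum_abs _ _).trans ?_)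
  calc _ ≤ ∑ c ∈ C, |w c| * (16 * (n : ℝ) ^ 2 * G) := by
        refine sum_le_sum fun c hc => ?_
        rw [abs_mul]
        exact mul_le_mul_of_nonneg_left (havg c hc) (abs_nonneg _)
    _ = (∑ c ∈ C, |w c|) * (16 * (n : ℝ) ^ 2 * G) := by rw [sum_mul]
    _ ≤ Bv * (16 * (n : ℝ) ^ 2 * G) := mul_le_mul_of_nonneg_right hvar (by positivity)
    _ = 16 * (n : ℝ) ^ 2 * G * Bv := by ring

/-! ### §2 The average over all matchings -/

/-- **(CG_1′) IN EVERY TYPE-CONSTANT DIRECTION, AVERAGED OVER ALL MATCHINGS (brick 144).** For every `a′ > 0` there is `n₀` such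
that for all `n ≥ n₀`: for every balanced exact design `(n,t,T,D,B_v,C,w)` with `2 ≤ D`, `D⁴ ≤ n`, `2D+1 ≤ T ≤ 7⌊√n⌋`, every
balanced block `|H| = n/2`, every `0 ≤ ψ ≤ G` on `[0,t]` and `|γ|,|λ|,|κ| ≤ 1`, the DESIGN VALUE of the tilted mask
`F(U,M) = ψ(|U∩H|)·C_{γ,λ,κ}(U,M)²` obeys `Σ_M Σ_U W(U,M)·F(U,M) ≤ 2·10⁴·(1+B_v)·G·n⁶·(e^{−a′D} + 2^{−⌊n/40⌋})` (non-aligned matchings by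
brick 143 with `β = 1/40`, aligned ones by the engine's `2^{−⌊n/40⌋}` crossing-count tails and the trivial bound).
[cite: Rothvoss2017, §2 (PDF pp. 5–6)] [cite: RollinRoss2010, §4.1 Thm 4.2] [cite: Durrett2019, §2.7] -/
theorem gammaDirection_designValue_le {a' : ℝ} (ha' : 0 < a') :
    ∃ n₀ : ℕ, ∀ n : ℕ, n₀ ≤ n → ∀ {t T D : ℕ} {Bv : ℝ} {C : Finset ℕ} {w : ℕ → ℝ},
    IsExactDesign n t T D Bv C w → 2 * D + 1 ≤ T → n ≤ 4 * t → 2 ≤ D → D ^ 4 ≤ n → T ≤ 7 * Nat.sqrt n →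
    ∀ (H : Finset (Fin n)), 2 * H.card = n →
    ∀ (ψ : ℤ → ℝ) {G : ℝ}, 0 ≤ G → (∀ x ∈ Icc (0 : ℤ) ((t : ℕ) : ℤ), |ψ x| ≤ G) →
    (∀ x ∈ Icc (0 : ℤ) ((t : ℕ) : ℤ), 0 ≤ ψ x) → ∀ (gam lam kap : ℝ), |gam| ≤ 1 → |lam| ≤ 1 → |kap| ≤ 1 →
    ∑ M : PMatch n, ∑ U : OddSet n, levelWeight n t C w U M *
        (ψ ((U.1 ∩ H).card : ℤ) *
          (∑ p : Fin n, (gam * (if (p ∈ H ∧ M.2.partner p ∈ H) then (1 : ℝ) else 0) +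
              (lam * ((if (p ∈ H ∧ M.2.partner p ∈ H) then (1 : ℝ) else 0) -
                (if (p ∉ H ∧ M.2.partner p ∉ H) then (1 : ℝ) else 0)) + (lam + kap))) *
            ((if p ∈ U.1 then (1 : ℝ) else 0) * (if M.2.partner p ∈ U.1 then (1 : ℝ) else 0))) ^ 2) ≤
      2 * 10 ^ 4 * (1 + Bv) * G * (n : ℝ) ^ 6 * (Real.exp (-(a' * D)) + (1 / 2 : ℝ) ^ (n / 40)) := by
  obtain ⟨n₁, h143⟩ := gammaDirection_value_le_exp (β := 1 / 40) (a' := a') (by norm_num) ha'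
  refine ⟨max n₁ 80, ?_⟩
  intro n hn t T D Bv C w hdes hDT hbal hD2 hD4 hT7 H hH ψ G hG0 hG hψ0 gam lam kap hgam hlam hkap
  have hn₁ : n₁ ≤ n := le_trans (le_max_left _ _) hn
  have hn80 : 80 ≤ n := le_trans (le_max_right _ _) hn
  have hBv : 0 ≤ Bv := le_trans (sum_nonneg fun c _ => abs_nonneg _) hdes.2.2.2.2.2.2
  -- abbreviations: the per-matching value `V`, the bounds `B₁`, `B₂`, the threshold `a₀`
  set V : PMatch n → ℝ := fun M => (Fintype.card (PMatch n) : ℝ) * ∑ U : OddSet n, levelWeight n t C w U M *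
        (ψ ((U.1 ∩ H).card : ℤ) *
          (∑ p : Fin n, (gam * (if (p ∈ H ∧ M.2.partner p ∈ H) then (1 : ℝ) else 0) +
              (lam * ((if (p ∈ H ∧ M.2.partner p ∈ H) then (1 : ℝ) else 0) -
                (if (p ∉ H ∧ M.2.partner p ∉ H) then (1 : ℝ) else 0)) + (lam + kap))) *
            ((if p ∈ U.1 then (1 : ℝ) else 0) * (if M.2.partner p ∈ U.1 then (1 : ℝ) else 0))) ^ 2) with hVdef
  obtain ⟨B₁, hB₁⟩ : ∃ e : ℝ, e = 2 * 10 ^ 4 * (1 + Bv) * G * (n : ℝ) ^ 6 * Real.exp (-(a' * D)) := ⟨_, rfl⟩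
  obtain ⟨B₂, hB₂⟩ : ∃ e : ℝ, e = 16 * (n : ℝ) ^ 2 * G * Bv := ⟨_, rfl⟩
  have hB₁0 : 0 ≤ B₁ := by rw [hB₁]; positivity
  have hB₂0 : 0 ≤ B₂ := by rw [hB₂]; positivity
  obtain ⟨a₀, ha₀⟩ : ∃ a : ℕ, a = n / 40 := ⟨_, rfl⟩
  -- the good matchings
  set good : Finset (PMatch n) := univ.filter fun M => a₀ < (M.1.filter (Crosses H)).card ∧
    (M.1.filter (Crosses H)).card + a₀ < H.card with hgood
  have hgoodV : ∀ M ∈ good, V M ≤ B₁ := by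
    intro M hM
    obtain ⟨h1, h2⟩ := (mem_filter.1 hM).2
    rw [← card_reps_vB_eq_card_crosses M H] at h1 h2
    have ha : (n : ℝ) ≤ 40 * ((a₀ : ℝ) + 1) := by
      have : n < 40 * (a₀ + 1) := by omega
      exact_mod_cast this.le
    have hlo : (1 / 40 : ℝ) * n ≤ (reps M.2.partner (vBH M.2.partner univ H ∪ vBN M.2.partner univ H)).card := by
      have : ((a₀ + 1 : ℕ) : ℝ) ≤ (reps M.2.partner (vBH M.2.partner univ H ∪ vBN M.2.partner univ H)).card := by
        exact_mod_cast h1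
      push_cast at this; linarith
    have hhi : ((reps M.2.partner (vBH M.2.partner univ H ∪ vBN M.2.partner univ H)).card : ℝ) ≤ (1 / 2 - 1 / 40) * n := by
      have : (((reps M.2.partner (vBH M.2.partner univ H ∪ vBN M.2.partner univ H)).card + a₀ + 1 : ℕ) : ℝ) ≤
          H.card := by exact_mod_cast h2
      have hHr : (H.card : ℝ) = (n : ℝ) / 2 := by
        have : ((2 * H.card : ℕ) : ℝ) = n := by exact_mod_cast hH
        push_cast at this; linarith
      push_cast at this; linarith
    rw [hB₁]
    exact h143 n hn₁ hdes hDT hbal hD2 hD4 hT7 M H hH hlo hhi ψ hG0 hG hψ0 gam lam kap hgam hlam hkap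
  -- every matching
  have hallV : ∀ M, V M ≤ B₂ := fun M => by rw [hB₂]; exact gamma_value_le_trivial hdes M H ψ hG0 hG hgam hlam hkap
  -- the bad matchings are few
  have hHc : 9 * a₀ + 1 ≤ H.card ∧ 9 * a₀ + 1 ≤ n - H.card ∧ n - H.card = H.card ∧ 9 * (a₀ + 1) ≤ H.card := by omega
  have hbad : (((univ.filter fun M : PMatch n => ¬ (a₀ < (M.1.filter (Crosses H)).card ∧
      (M.1.filter (Crosses H)).card + a₀ < H.card)).card : ℕ) : ℝ) ≤
      2 * (1 / 2 : ℝ) ^ a₀ * (Fintype.card (PMatch n) : ℝ) := by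
    have hsub : (univ.filter fun M : PMatch n => ¬ (a₀ < (M.1.filter (Crosses H)).card ∧
        (M.1.filter (Crosses H)).card + a₀ < H.card)) ⊆
        (univ.filter fun M : PMatch n => (M.1.filter (Crosses H)).card ≤ a₀) ∪
        (univ.filter fun M : PMatch n => H.card ≤ (M.1.filter (Crosses H)).card + a₀) := by
      intro M hM
      rw [mem_filter] at hM
      rw [mem_union, mem_filter, mem_filter]
      by_cases h : (M.1.filter (Crosses H)).card ≤ a₀
      · exact Or.inl ⟨mem_univ _, h⟩
      · right; refine ⟨mem_univ _, ?_⟩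
        by_contra h'
        exact hM.2 ⟨by omega, by omega⟩
    have h1 := card_pmatch_crosses_le_le H hHc.1 hHc.2.1
    have h2 := card_pmatch_le_crosses_le H hHc.2.2.1 hHc.2.2.2
    have h3 := (card_le_card hsub).trans (card_union_le _ _)
    have h3' : (((univ.filter fun M : PMatch n => ¬ (a₀ < (M.1.filter (Crosses H)).card ∧
        (M.1.filter (Crosses H)).card + a₀ < H.card)).card : ℕ) : ℝ) ≤
        (((univ.filter fun M : PMatch n => (M.1.filter (Crosses H)).card ≤ a₀).card : ℕ) : ℝ) +
        (((univ.filter fun M : PMatch n => H.card ≤ (M.1.filter (Crosses H)).card + a₀).card : ℕ) : ℝ) := by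
      exact_mod_cast h3
    linarith
  -- the average
  have hPMpos : ∀ M : PMatch n, (0 : ℝ) < Fintype.card (PMatch n) := fun M => by
    have : 0 < Fintype.card (PMatch n) := Fintype.card_pos_iff.2 ⟨M⟩
    exact_mod_cast this
  have hsumV : ∑ M : PMatch n, ∑ U : OddSet n, levelWeight n t C w U M *
        (ψ ((U.1 ∩ H).card : ℤ) *
          (∑ p : Fin n, (gam * (if (p ∈ H ∧ M.2.partner p ∈ H) then (1 : ℝ) else 0) +
              (lam * ((if (p ∈ H ∧ M.2.partner p ∈ H) then (1 : ℝ) else 0) -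
                (if (p ∉ H ∧ M.2.partner p ∉ H) then (1 : ℝ) else 0)) + (lam + kap))) *
            ((if p ∈ U.1 then (1 : ℝ) else 0) * (if M.2.partner p ∈ U.1 then (1 : ℝ) else 0))) ^ 2) =
      ∑ M : PMatch n, (Fintype.card (PMatch n) : ℝ)⁻¹ * V M := by
    refine sum_congr rfl fun M _ => ?_
    rw [hVdef]
    simp only []
    rw [← mul_assoc, inv_mul_cancel₀ (hPMpos M).ne', one_mul]
  rw [hsumV, ← mul_sum, ← sum_filter_add_sum_filter_not univ (fun M : PMatch n =>
    a₀ < (M.1.filter (Crosses H)).card ∧ (M.1.filter (Crosses H)).card + a₀ < H.card)]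
  have hgood_sum : ∑ M ∈ good, V M ≤ (good.card : ℝ) * B₁ := by
    rw [← nsmul_eq_mul, ← sum_const]; exact sum_le_sum hgoodV
  have hbad_sum : ∑ M ∈ univ.filter (fun M : PMatch n => ¬ (a₀ < (M.1.filter (Crosses H)).card ∧
      (M.1.filter (Crosses H)).card + a₀ < H.card)), V M ≤
      ((univ.filter fun M : PMatch n => ¬ (a₀ < (M.1.filter (Crosses H)).card ∧
        (M.1.filter (Crosses H)).card + a₀ < H.card)).card : ℝ) * B₂ := by
    rw [← nsmul_eq_mul, ← sum_const]; exact sum_le_sum fun M _ => hallV M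
  have hgood_card : (good.card : ℝ) ≤ Fintype.card (PMatch n) := by
    exact_mod_cast card_le_univ good
  -- if there is no matching the sum is empty
  by_cases hPM : Fintype.card (PMatch n) = 0
  · have : IsEmpty (PMatch n) := Fintype.card_eq_zero_iff.1 hPM
    simp only [univ_eq_empty, filter_empty, sum_empty, add_zero, mul_zero]
    positivity
  have hPMr : (0 : ℝ) < Fintype.card (PMatch n) := by
    have : 0 < Fintype.card (PMatch n) := Nat.pos_of_ne_zero hPM
    exact_mod_cast this
  rw [← hgood]
  calc (Fintype.card (PMatch n) : ℝ)⁻¹ * (∑ M ∈ good, V M +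
        ∑ M ∈ univ.filter (fun M : PMatch n => ¬ (a₀ < (M.1.filter (Crosses H)).card ∧
          (M.1.filter (Crosses H)).card + a₀ < H.card)), V M)
      ≤ (Fintype.card (PMatch n) : ℝ)⁻¹ * ((Fintype.card (PMatch n) : ℝ) * B₁ +
          (2 * (1 / 2 : ℝ) ^ a₀ * (Fintype.card (PMatch n) : ℝ)) * B₂) := by
        refine mul_le_mul_of_nonneg_left ?_ (by positivity)
        nlinarith [hgood_sum, hbad_sum, hgood_card, hbad, hB₁0, hB₂0]
    _ = B₁ + 2 * (1 / 2 : ℝ) ^ a₀ * B₂ := by field_simp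
    _ ≤ 2 * 10 ^ 4 * (1 + Bv) * G * (n : ℝ) ^ 6 * (Real.exp (-(a' * D)) + (1 / 2 : ℝ) ^ (n / 40)) := by
        rw [hB₁, hB₂, ha₀, mul_add]
        have hn1 : (1 : ℝ) ≤ n := by exact_mod_cast (show 1 ≤ n by omega)
        have hn26 : (n : ℝ) ^ 2 ≤ (n : ℝ) ^ 6 := pow_le_pow_right₀ hn1 (by norm_num)
        have hp : (0 : ℝ) ≤ (1 / 2 : ℝ) ^ (n / 40) := by positivity
        have : 2 * (1 / 2 : ℝ) ^ (n / 40) * (16 * (n : ℝ) ^ 2 * G * Bv) ≤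
            2 * 10 ^ 4 * (1 + Bv) * G * (n : ℝ) ^ 6 * (1 / 2 : ℝ) ^ (n / 40) := by
          have h32 : 32 * ((n : ℝ) ^ 2 * G * Bv) ≤ 2 * 10 ^ 4 * ((1 + Bv) * G * (n : ℝ) ^ 6) := by
            nlinarith [mul_nonneg hG0 hBv, mul_le_mul_of_nonneg_left hn26 (mul_nonneg hG0 hBv),
              mul_nonneg hG0 (pow_nonneg (by linarith : (0:ℝ) ≤ n) 6)]
          nlinarith [mul_le_mul_of_nonneg_left h32 hp]
        linarith

/-! ### §3 In the crux's own parameters: `T = Tq n`, `D = dq n`, variation `20` -/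

/-- **Brick 144 in the crux's vocabulary.** For every `a′ > 0` there is `n₀` such that for all `n ≥ n₀`, every BALANCED
exact design of the crux's shape (`IsBalancedDesign n t (Tq n) (dq n) 20 C w`), every balanced block `|H| = n/2`, every
`0 ≤ ψ ≤ G` on `[0,t]` and `|γ|,|λ|,|κ| ≤ 1`:
`Σ_M Σ_U W(U,M)·ψ(|U∩H|)·C_{γ,λ,κ}(U,M)² ≤ 42·10⁴·G·n⁶·(e^{−a′·dq n} + 2^{−⌊n/40⌋})` — the design value of every `H`-symmetric mask
tilted by the square of any type-constant containment form against the weight `levelWeight n t C w` of `TracialDecayExp20`.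
[cite: Rothvoss2017, §2 (PDF p. 6)] -/
theorem gammaDirection_designValue_le_chebyshev {a' : ℝ} (ha' : 0 < a') :
    ∃ n₀ : ℕ, ∀ n : ℕ, n₀ ≤ n → ∀ {t : ℕ} {C : Finset ℕ} {w : ℕ → ℝ},
    IsBalancedDesign n t (Tq n) (dq n) 20 C w →
    ∀ (H : Finset (Fin n)), 2 * H.card = n →
    ∀ (ψ : ℤ → ℝ) {G : ℝ}, 0 ≤ G → (∀ x ∈ Icc (0 : ℤ) ((t : ℕ) : ℤ), |ψ x| ≤ G) →
    (∀ x ∈ Icc (0 : ℤ) ((t : ℕ) : ℤ), 0 ≤ ψ x) → ∀ (gam lam kap : ℝ), |gam| ≤ 1 → |lam| ≤ 1 → |kap| ≤ 1 →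
    ∑ M : PMatch n, ∑ U : OddSet n, levelWeight n t C w U M *
        (ψ ((U.1 ∩ H).card : ℤ) *
          (∑ p : Fin n, (gam * (if (p ∈ H ∧ M.2.partner p ∈ H) then (1 : ℝ) else 0) +
              (lam * ((if (p ∈ H ∧ M.2.partner p ∈ H) then (1 : ℝ) else 0) -
                (if (p ∉ H ∧ M.2.partner p ∉ H) then (1 : ℝ) else 0)) + (lam + kap))) *
            ((if p ∈ U.1 then (1 : ℝ) else 0) * (if M.2.partner p ∈ U.1 then (1 : ℝ) else 0))) ^ 2) ≤
      42 * 10 ^ 4 * G * (n : ℝ) ^ 6 * (Real.exp (-(a' * dq n)) + (1 / 2 : ℝ) ^ (n / 40)) := by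
  obtain ⟨n₁, h144⟩ := gammaDirection_designValue_le ha'
  refine ⟨max n₁ 16, ?_⟩
  intro n hn t C w hdes H hH ψ G hG0 hG hψ0 gam lam kap hgam hlam hkap
  obtain ⟨h1, h2, h3, h4⟩ := dq_Tq_facts (le_trans (le_max_right _ _) hn)
  have h := h144 n (le_trans (le_max_left _ _) hn) hdes.1 h3 hdes.2 h2 h1 h4 H hH ψ hG0 hG hψ0 gam lam kap hgam hlam hkap
  refine h.trans (le_of_eq ?_)
  ring

end Summit.PneNP.PneNP.Theorems.ChebyshevTracialDesignGammaDirectionAverage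

end
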